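import Literature.Computability.MetaComplexity.DistProblems
import Literature.Computability.Complexity.CoinBlocksOr
import Literature.Computability.Complexity.HashBricks
import Literature.Computability.Complexity.CookReducibilityTransitive
import HarnessLib

/-!
# Complexity meta: encoding a parameter into the length of a uniform sample (Hirahara 2021, Lemma 3.6, step 1)

Topic `Literature/Computability/MetaComplexity`. First file of the inline proof of a generator-free
form of Lemma 3.6 of S. Hirahara, *Average-case hardness of NP from exponential worst-case hardness
assumptions* (STOC 2021; ECCC TR21-058, p. 21) used in the proof plan of
`Hirahara2021_languageCompression` (Thm. 4.2): one-sided-error heuristics for a *parameterized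
uniform distribution* (Def. 3.5: sample `r ← {0,1}^ℓ`, output `(r, 1^m)`) from the hypothesis
`coNP × {U, T} ⊆ Avg¹_{1-n^{-c}} P`, which only speaks about the plain uniform ensemble. The printed
proof begins: "The idea is to encode the information of integers `p` and `q ∈ ℕ` as the length of
instances. Specifically, define a language `L'` so that `x ∈ L'` if and only if `⟨p,q⟩ := |x|` and
`(r, 1^q) ∈ L`, where `r` denotes the first `p` bits of `x`. Observe that `L' ∈ coNP`." This file
formalises that step for a language `L'` of pairs `(r, 1^m) = paramEnc (r, m)` in `NP` (the
complementary reading; the heuristics of the sequel have no false negatives instead of no false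
positives). Both the sample length `ℓ = |r|` and the parameter `m` are encoded in the length (so no
computability hypothesis on `m ↦ ℓ` is needed and one heuristic serves all pairs `(ℓ, m)`):

* `ParamUniform.padLen ℓ m = (ℓ + m + 1)² + m` — the padded length, injective in `(ℓ, m)`
  (`padLen_injective`: `m < ℓ + m + 1`, so `√N = ℓ + m + 1`; this is `Nat.pair`'s second branch), and
  the pad length `junkLen ℓ m = padLen ℓ m - ℓ`;
* `ParamUniform.padLang L' = {u | ∃ ℓ m, |u| = padLen ℓ m ∧ (u ↾ ℓ, 1^m) ∈ L'}` with
  `append_mem_padLang_iff : |r| = ℓ → |j| = junkLen ℓ m → (r ++ j ∈ padLang ↔ (r, 1^m) ∈ L')`;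
* `ParamUniform.padLang_mem_NP` — `L' ∈ NP ⟹ padLang L' ∈ NP` (certificate `⟨1^ℓ, ⟨1^m, y⟩⟩`; the
  verifier recomputes `padLen ℓ m` in unary with the bricks `sU`, `padLenU` and defers to the verifier
  of `L'`), `compl_padLang_mem_coNP`.

The aggregation over the pad (Hirahara pads with outputs of the pseudorandom generator of Lemma
3.4; the sequels `ParamUniformWitness.lean` / `ParamUniformHeuristics.lean` aggregate over a
uniformly random pad inside a `pr-coRP` promise problem and use `PromiseBPP' ⊆ PromiseP` instead)
is not in this file.

## References

* S. Hirahara, ECCC TR21-058 (2021), Def. 3.5 (parameterized uniform distribution, p. 20),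
  Lemma 3.6 and its proof (p. 21) [Hirahara2021].
* S. Arora, B. Barak, *Computational Complexity: A Modern Approach*, CUP 2009, Def. 2.1 (`NP` by
  certificates), §1.3 [AroraBarakCC2009].
-/

noncomputable section

namespace Literature.Computability.MetaComplexity

open _root_.Computability Polynomial Complexity Complexity.Classes Complexity.Nondeterministic Complexity.Brick
  Complexity.Plumb Complexity.OracleCompose Complexity.HashBricks Complexity.LenCmp

namespace ParamUniform

/-! ### The lengths -/

/-- The side `s = ℓ + m + 1` of the square in the padded length. [folklore] -/
def sLen (ℓ m : ℕ) : ℕ := ℓ + m + 1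

/-- **The padded length** `N(ℓ, m) = s² + m`, `s = ℓ + m + 1` ("encode the information of integers
… as the length of instances"; injective in `(ℓ, m)`). [cite: Hirahara2021, Lemma 3.6 (proof)] -/
def padLen (ℓ m : ℕ) : ℕ := sLen ℓ m * sLen ℓ m + m

/-- The pad length `J(ℓ, m) = N(ℓ, m) - ℓ` (`ℕ`-subtraction; `ℓ ≤ N` always, `le_padLen_left`).
[cite: Hirahara2021, Lemma 3.6 (proof)] -/
def junkLen (ℓ m : ℕ) : ℕ := padLen ℓ m - ℓ

/-- `m < s`. [folklore] -/
theorem lt_sLen (ℓ m : ℕ) : m < sLen ℓ m := by unfold sLen; omega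

/-- `ℓ ≤ N(ℓ, m)`. [folklore] -/
theorem le_padLen_left (ℓ m : ℕ) : ℓ ≤ padLen ℓ m := by
  have h2 : sLen ℓ m ≤ sLen ℓ m * sLen ℓ m := Nat.le_mul_self _
  unfold padLen; unfold sLen at h2 ⊢; omega

/-- `m ≤ N(ℓ, m)`. [folklore] -/
theorem le_padLen_right (ℓ m : ℕ) : m ≤ padLen ℓ m := by unfold padLen; omega

/-- `1 ≤ N(ℓ, m)`. [folklore] -/
theorem one_le_padLen (ℓ m : ℕ) : 1 ≤ padLen ℓ m := by
  have := lt_sLen ℓ m; unfold padLen; nlinarith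

/-- `ℓ + J(ℓ, m) = N(ℓ, m)`. [folklore] -/
theorem add_junkLen (ℓ m : ℕ) : ℓ + junkLen ℓ m = padLen ℓ m := by
  have := le_padLen_left ℓ m
  unfold junkLen; omega

/-- `√N = s` (as `m ≤ 2s`). [folklore] -/
theorem sqrt_padLen (ℓ m : ℕ) : Nat.sqrt (padLen ℓ m) = sLen ℓ m := by
  unfold padLen
  exact Nat.sqrt_add_eq _ (by have := lt_sLen ℓ m; omega)

/-- **The padded length determines the sample length and the parameter.**
[cite: Hirahara2021, Lemma 3.6 (proof)] -/
theorem padLen_injective {ℓ₁ m₁ ℓ₂ m₂ : ℕ} (h : padLen ℓ₁ m₁ = padLen ℓ₂ m₂) : ℓ₁ = ℓ₂ ∧ m₁ = m₂ := by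
  have hs : sLen ℓ₁ m₁ = sLen ℓ₂ m₂ := by rw [← sqrt_padLen ℓ₁ m₁, ← sqrt_padLen ℓ₂ m₂, h]
  unfold padLen at h
  rw [hs] at h
  have hm : m₁ = m₂ := by omega
  unfold sLen at hs
  exact ⟨by omega, hm⟩

/-- `N(ℓ, m) ≤ ((ℓ + m) + 1)² + (ℓ + m)`: a polynomial bound in `ℓ + m`. [folklore] -/
theorem padLen_le_poly (ℓ m : ℕ) : padLen ℓ m ≤ ((X + 1) * (X + 1) + X : Polynomial ℕ).eval (ℓ + m) := by
  simp only [eval_add, eval_mul, eval_X, eval_one, padLen, sLen]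
  nlinarith

/-! ### The padded language -/

/-- **The padded language** of a language `L'` of pairs `(r, 1^m)`:
`{u | ∃ ℓ m, |u| = N(ℓ, m) ∧ (u ↾ ℓ, 1^m) ∈ L'}` — sample length and parameter are read off the length,
the sample off the first `ℓ` bits, the remaining `J(ℓ, m)` bits are padding.
[cite: Hirahara2021, Lemma 3.6 (proof: the language L')] -/
def padLang (L' : Language Bool) : Language Bool :=
  {u | ∃ ℓ m : ℕ, u.length = padLen ℓ m ∧ paramEnc (u.take ℓ, m) ∈ L'}

/-- Membership in the padded language at a padded length. [cite: Hirahara2021, Lemma 3.6 (proof)] -/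
theorem mem_padLang_iff {L' : Language Bool} {u : List Bool} {ℓ m : ℕ} (hu : u.length = padLen ℓ m) :
    u ∈ padLang L' ↔ paramEnc (u.take ℓ, m) ∈ L' := by
  constructor
  · rintro ⟨ℓ', m', hm', h⟩
    obtain ⟨rfl, rfl⟩ := padLen_injective (hm'.symm.trans hu)
    exact h
  · exact fun h => ⟨ℓ, m, hu, h⟩

/-- **Sample and pad**: for `|r| = ℓ` and `|j| = J(ℓ, m)`, `r ++ j ∈ padLang ↔ (r, 1^m) ∈ L'`.
[cite: Hirahara2021, Lemma 3.6 (proof)] -/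
theorem append_mem_padLang_iff {L' : Language Bool} {r j : List Bool} {ℓ m : ℕ} (hr : r.length = ℓ)
    (hj : j.length = junkLen ℓ m) : r ++ j ∈ padLang L' ↔ paramEnc (r, m) ∈ L' := by
  have hu : (r ++ j).length = padLen ℓ m := by
    rw [List.length_append, hr, hj, add_junkLen]
  rw [mem_padLang_iff hu, List.take_left' hr]

/-! ### The lengths in unary, as bricks on `⟨1^ℓ, 1^m⟩` -/

/-- `unaryEncodeNat n = ones n` (twin of `Cryptography.CondRed.unaryEncodeNat_eq_ones`, whose file is
not imported here). [folklore] -/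
theorem unaryEncodeNat_eq_ones (n : ℕ) : unaryEncodeNat n = ones n := Complexity.unaryEncodeNat_eq_replicate n

/-- `onesFn w = 1^{|w|}` (twin of `Cryptography.CondRed.onesFn_eq_ones`, not imported here). [folklore] -/
theorem onesFn_eq_ones (w : List Bool) : onesFn w = ones w.length := unaryEncodeNat_eq_ones _

/-- `|1^n| = n` (`unaryDecodeNat = List.length`; twin of `GapMINKTDecision.length_unaryEncodeNat`, whose
file is not imported here). [folklore] -/
@[simp] theorem length_unaryEncodeNat (n : ℕ) : (unaryEncodeNat n).length = n := unary_decode_encode_nat n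

/-- `|ones n| = n` (the `length_ones'` of several machine files, none imported here). [folklore] -/
@[simp] theorem length_ones (n : ℕ) : (ones n).length = n := by simp [ones]

/-- `1^a ++ 1^b = 1^{a+b}` (the `Com.ones_append` of `StackUnary.lean`). [folklore] -/
private theorem ones_append_ones (a b : ℕ) : ones a ++ ones b = ones (a + b) := List.replicate_append_replicate ..

/-- `sU ⟨a, b⟩ = 1^{s(|a|, |b|)}`. [folklore] -/
def sU : List Bool → List Bool := concatFn ∘ fanoutFn (concatFn ∘ fanoutFn (onesFn ∘ fstF) (onesFn ∘ sndF)) fun _ => [true]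

/-- `padLenU ⟨a, b⟩ = 1^{N(|a|, |b|)}`. [folklore] -/
def padLenU : List Bool → List Bool := concatFn ∘ fanoutFn (umulFn ∘ fanoutFn sU sU) (onesFn ∘ sndF)

/-- `junkLenU ⟨a, b⟩ = 1^{J(|a|, |b|)}`. [folklore] -/
def junkLenU : List Bool → List Bool := dropFn ∘ fanoutFn (onesFn ∘ fstF) padLenU

/-- Value of `sU`. [folklore] -/
theorem sU_boolPair (a b : List Bool) : sU (boolPair a b) = ones (sLen a.length b.length) := by
  simp only [sU, Function.comp_apply, fanoutFn_apply, concatFn_boolPair, fstF_boolPair, sndF_boolPair,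
    onesFn_eq_ones, sLen]
  rw [show [true] = ones 1 from rfl, ones_append_ones, ones_append_ones]

/-- Value of `padLenU`. [folklore] -/
theorem padLenU_boolPair (a b : List Bool) : padLenU (boolPair a b) = ones (padLen a.length b.length) := by
  simp only [padLenU, Function.comp_apply, fanoutFn_apply, concatFn_boolPair, sU_boolPair, umulFn_boolPair,
    sndF_boolPair, onesFn_eq_ones, padLen]
  rw [ones_append_ones]

/-- Value of `junkLenU`. [folklore] -/
theorem junkLenU_boolPair (a b : List Bool) : junkLenU (boolPair a b) = ones (junkLen a.length b.length) := by
  simp only [junkLenU, Function.comp_apply, fanoutFn_apply, dropFn_boolPair, fstF_boolPair, padLenU_boolPair,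
    onesFn_eq_ones, length_ones, junkLen]
  simp [ones]

/-- `sU ∈ FP`. [folklore] -/
theorem sU_mem_FP : sU ∈ FP :=
  comp_mem_FP concatFn_mem_FP (fanoutFn_mem_FP (comp_mem_FP concatFn_mem_FP
    (fanoutFn_mem_FP (comp_mem_FP onesFn_mem_FP fstF_mem_FP) (comp_mem_FP onesFn_mem_FP sndF_mem_FP))) (const_mem_FP _))

/-- `padLenU ∈ FP`. [folklore] -/
theorem padLenU_mem_FP : padLenU ∈ FP :=
  comp_mem_FP concatFn_mem_FP (fanoutFn_mem_FP (comp_mem_FP umulFn_mem_FP (fanoutFn_mem_FP sU_mem_FP sU_mem_FP))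
    (comp_mem_FP onesFn_mem_FP sndF_mem_FP))

/-- `junkLenU ∈ FP`. [folklore] -/
theorem junkLenU_mem_FP : junkLenU ∈ FP :=
  comp_mem_FP dropFn_mem_FP (fanoutFn_mem_FP (comp_mem_FP onesFn_mem_FP fstF_mem_FP) padLenU_mem_FP)

/-! ### The padded language is in `NP` -/

section NP

variable (R' : Language Bool) (p' : Polynomial ℕ)

/-- The re-encoded instance `(u ↾ ℓ, 1^m)` of a verifier input `⟨u, ⟨1^ℓ, ⟨1^m, y⟩⟩⟩`. [folklore] -/
def instF : List Bool → List Bool := fanoutFn (takeFn ∘ fanoutFn (nthF 0 ∘ sndF) fstF) (onesFn ∘ nthF 1 ∘ sndF)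

/-- The certificate `y` of `L'` in a verifier input `⟨u, ⟨1^ℓ, ⟨1^m, y⟩⟩⟩`. [folklore] -/
def certF : List Bool → List Bool := sndPow 1 ∘ sndF

/-- **The verifier of the padded language**: on `⟨u, ⟨1^ℓ, ⟨1^m, y⟩⟩⟩` check `|u| = N(ℓ, m)`, that `y`
certifies `(u ↾ ℓ, 1^m)` for the verifier `R'` of `L'`, and `|y| ≤ p'(|(u ↾ ℓ, 1^m)|)`.
[cite: Hirahara2021, Lemma 3.6 (proof: "Observe that L' ∈ coNP")] -/
def verifier : Language Bool :=
  ({w | (onesFn ∘ fstF) w = (padLenU ∘ fanoutFn (nthF 0 ∘ sndF) (nthF 1 ∘ sndF)) w} : Language Bool) ⊓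
    ((fanoutFn instF certF ⁻¹' R') ⊓ (fanoutFn instF certF ⁻¹' LenLe p'))

variable {R' p'}

/-- The verifier is polynomial time for `R' ∈ P`. [cite: AroraBarakCC2009, Def. 2.1] -/
theorem verifier_mem_P (hR' : R' ∈ Classes.P) : verifier R' p' ∈ Classes.P := by
  have h0 : nthF 0 ∘ sndF ∈ FP := comp_mem_FP (nthF_mem_FP 0) sndF_mem_FP
  have h1 : nthF 1 ∘ sndF ∈ FP := comp_mem_FP (nthF_mem_FP 1) sndF_mem_FP
  have hinst : instF ∈ FP :=
    fanoutFn_mem_FP (comp_mem_FP takeFn_mem_FP (fanoutFn_mem_FP h0 fstF_mem_FP)) (comp_mem_FP onesFn_mem_FP h1)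
  have hpair : fanoutFn instF certF ∈ FP := fanoutFn_mem_FP hinst (comp_mem_FP (sndPow_mem_FP 1) sndF_mem_FP)
  refine inter_mem_P ?_ (inter_mem_P (preimage_mem_P hR' hpair) (preimage_mem_P (LenLe_mem_P p') hpair))
  exact setOf_apply_eq_apply_mem_P (comp_mem_FP onesFn_mem_FP fstF_mem_FP) (comp_mem_FP padLenU_mem_FP (fanoutFn_mem_FP h0 h1))

/-- Semantics of the verifier on `⟨u, c⟩` (any `c`; `ℓ := |c₀|`, `m := |c₁|`, `y := c₂₊`).
[cite: Hirahara2021, Lemma 3.6 (proof)] -/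
theorem boolPair_mem_verifier_iff (u c : List Bool) :
    boolPair u c ∈ verifier R' p' ↔
      u.length = padLen (nthF 0 c).length (nthF 1 c).length ∧
        boolPair (paramEnc (u.take (nthF 0 c).length, (nthF 1 c).length)) (sndPow 1 c) ∈ R' ∧
          (sndPow 1 c).length ≤ p'.eval (paramEnc (u.take (nthF 0 c).length, (nthF 1 c).length)).length := by
  have hinst : instF (boolPair u c) = paramEnc (u.take (nthF 0 c).length, (nthF 1 c).length) := by
    simp only [instF, fanoutFn_apply, Function.comp_apply, fstF_boolPair, sndF_boolPair, takeFn_boolPair, paramEnc,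
      onesFn]
  have hcert : certF (boolPair u c) = sndPow 1 c := by simp [certF]
  have hlen : (boolPair u c ∈ ({w | (onesFn ∘ fstF) w =
      (padLenU ∘ fanoutFn (nthF 0 ∘ sndF) (nthF 1 ∘ sndF)) w} : Language Bool)) ↔
      u.length = padLen (nthF 0 c).length (nthF 1 c).length := by
    change (onesFn ∘ fstF) (boolPair u c) = (padLenU ∘ fanoutFn (nthF 0 ∘ sndF) (nthF 1 ∘ sndF)) (boolPair u c) ↔ _
    simp only [Function.comp_apply, fanoutFn_apply]
    rw [fstF_boolPair, sndF_boolPair, padLenU_boolPair, onesFn_eq_ones]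
    constructor
    · intro h; simpa using congr_arg List.length h
    · intro h; rw [h]
  unfold verifier
  change (boolPair u c ∈ ({w | (onesFn ∘ fstF) w = (padLenU ∘ fanoutFn (nthF 0 ∘ sndF) (nthF 1 ∘ sndF)) w} : Language Bool) ∧
    (fanoutFn instF certF (boolPair u c) ∈ R' ∧ fanoutFn instF certF (boolPair u c) ∈ LenLe p')) ↔ _
  rw [hlen, fanoutFn_apply, hinst, hcert, boolPair_mem_LenLe]

/-- **The padded language of an `NP` language is in `NP`** ("Observe that `L' ∈ coNP`", in the
complementary reading): guess `1^ℓ`, `1^m` and a certificate of `(u ↾ ℓ, 1^m) ∈ L'`.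
[cite: Hirahara2021, Lemma 3.6 (proof)] -/
theorem padLang_mem_NP {L' : Language Bool} (hL' : L' ∈ NP) : padLang L' ∈ NP := by
  obtain ⟨R', hR', p', hL'⟩ := hL'
  -- certificate length: `|⟨1^ℓ, ⟨1^m, y⟩⟩| = 2ℓ + 2 + 2m + 2 + |y|`, `|y| ≤ p'(2ℓ + 2 + m)`, `ℓ, m ≤ |u|`
  refine ⟨verifier R' p', verifier_mem_P hR', 4 * X + 4 + p'.comp (3 * X + 2), fun u => ?_⟩
  constructor
  · rintro ⟨ℓ, m, hu, hmem⟩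
    obtain ⟨y, hy, hRy⟩ := (hL' _).1 hmem
    refine ⟨boolPair (unaryEncodeNat ℓ) (boolPair (unaryEncodeNat m) y), ?_, ?_⟩
    · have hm : m ≤ u.length := hu ▸ le_padLen_right ℓ m
      have hℓ : ℓ ≤ u.length := hu ▸ le_padLen_left ℓ m
      have hlenv : (paramEnc (u.take ℓ, m)).length ≤ 3 * u.length + 2 := by
        simp only [paramEnc, length_boolPair, List.length_take_of_le hℓ, length_unaryEncodeNat]
        omega
      have hy' : y.length ≤ p'.eval (3 * u.length + 2) := hy.trans (TM2Iter.eval_mono p' hlenv)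
      simp only [length_boolPair, length_unaryEncodeNat, eval_add, eval_mul, eval_ofNat, eval_X, eval_comp]
      omega
    · rw [boolPair_mem_verifier_iff]
      simp only [nthF, Function.comp_apply, fstF_boolPair, sndF_boolPair, sndPow_succ_boolPair, sndPow_zero_boolPair,
        length_unaryEncodeNat]
      exact ⟨hu, hRy, hy⟩
  · rintro ⟨c, -, hc⟩
    rw [boolPair_mem_verifier_iff] at hc
    obtain ⟨hu, hR, hy⟩ := hc
    exact ⟨(nthF 0 c).length, (nthF 1 c).length, hu, (hL' _).2 ⟨sndPow 1 c, hy, hR⟩⟩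

/-- Hence its complement is in `coNP` (the form fed to the hypothesis `coNP × {U, T} ⊆ Avg¹P`).
[cite: Hirahara2021, Lemma 3.6 (proof)] -/
theorem compl_padLang_mem_coNP {L' : Language Bool} (hL' : L' ∈ NP) : (padLang L')ᶜ ∈ coNP := by
  change (padLang L')ᶜᶜ ∈ NP
  rw [compl_compl]
  exact padLang_mem_NP hL'

end NP

end ParamUniform

end Literature.Computability.MetaComplexity
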